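import Literature.AlgebraicGeometry.HodgeTheory.MiddleDimensionReductionHolds
import Literature.AlgebraicGeometry.HodgeTheory.LefschetzOneOneHolds
import Summits.HodgeConjecture.HodgeConjecture.Statement
import HarnessLib

/-!
# The middle-degree form of the summit: `HodgeConjecture ⟺` Hodge classes of degree `2m` on `2m`-folds, `m ≥ 2`

Solo-blind residency on `HodgeConjecture`, session s172; claims SB-C1330 – SB-C1332 of its
`CLAIMS.jsonl`, companion prose `work/s172/middle.md`, front sheet `paper/sharpest.md` §1 (1e).

This is a KERNEL COROLLARY of theorems already in the tree, recorded at summit level. Write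
`MiddleHodge m` for: on every smooth projective complex variety `Y` of dimension `2m`, every
rational class of Hodge type `(m, m)` in `H^{2m}(Y(ℂ); ℂ)` is algebraic (the Hodge conjecture in the
middle degree of even-dimensional varieties). Then

* `hodgeConjecture_iff_forall_middleHodge` : `HodgeConjecture ↔ ∀ m, MiddleHodge m`. The forward
  direction is specialisation; the backward direction is the product-with-projective-space trick of
  Brosnan–Fang–Nie–Pearlstein (Invent. Math. 177 (2009), §6 Lemma 48): a Hodge class of degree
  `2p` on an `n`-fold `X` is moved into the middle degree of `Y = X × ℙʳ`, `r = |n - 2p|`: for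
  `2p < n` as `c' = pr₁^* c ∪ pr₂^* hʳ` (`h` the hyperplane class), read back as `c = pr₁_* c'`; for
  `2p > n` as `c' = pr₁^* c`, read back as `c = pr₁_* (c' ∪ pr₂^* hʳ)` (equivalently by restriction to a
  section `X × {t}`) — `pr₁^*` and `∪ pr₂^* hʳ` preserve rationality and Hodge type, `pr₁_*` and
  `∪ pr₂^* hʳ` preserve algebraicity (printed proof: products with `ℙʳ` for `2p > n`, general linear
  sections and weak Lefschetz for `2p < n`). In the tree this is the unconditional theorem
  `Literature.AlgebraicGeometry.HodgeTheory.middleDimensionReduction_holds`, consumed through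
  `hodgeConjectureFor_of_middleDimension_holds` (the Hodge-model conjunct of `HodgeConjectureFor` being the theorem
  `nonempty_hodgeModel_holds`).
* `middleHodge_zero`, `middleHodge_one` : the cases `m = 0` (points) and `m = 1` (divisor classes on
  surfaces, the Lefschetz theorem on `(1,1)`-classes) are theorems of the tree
  (`hodgeConjectureFor_of_dim_le_three_holds`).
* `hodgeConjecture_iff_forall_two_le_middleHodge` : hence `HodgeConjecture ↔ ∀ m ≥ 2, MiddleHodge m`;
  the first open instance is `m = 2`, Hodge classes of type `(2,2)` on fourfolds.

What it buys (bookkeeping, not a reduction of difficulty): every named open statement of the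
residency's front sheet (`paper/sharpest.md` §4) is an instance of some `MiddleHodge m`, and a proof
strategy for the summit may without loss be organised by the single parameter `m ≥ 2`.

## References

* [BrosnanFangNiePearlstein2009] P. Brosnan, H. Fang, Z. Nie, G. Pearlstein, Singularities of
  admissible normal functions, Invent. Math. 177 (2009), §6 Lemma 48 (arXiv:0711.0964).
* [VoisinHodgeI2002] C. Voisin, Hodge Theory and Complex Algebraic Geometry I (2002), Thm. 11.30
  (Lefschetz theorem on `(1,1)`-classes), §11.3.
* [Deligne2000] P. Deligne, The Hodge conjecture, Clay problem description (2000), §1.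
-/

noncomputable section

open Literature.AlgebraicGeometry Literature.AlgebraicGeometry.Motives
open Literature.AlgebraicGeometry.HodgeTheory
open Literature.AlgebraicTopology.SingularHomology

namespace Summit.HodgeConjecture.HodgeConjecture.Theorems.SoloBlind

/-- **The Hodge conjecture in the middle degree of `2m`-folds.** `MiddleHodge m`: for every smooth
projective complex variety `X` of dimension `2m`, every rational class of Hodge type `(m, m)` in
`H^{2m}(X(ℂ); ℂ)` lies in the `ℚ`-span of the classes of codimension-`m` algebraic cycles.
[cite: Deligne2000, §1] [cite: BrosnanFangNiePearlstein2009, §6 Lemma 48] -/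
@[conjecture] def MiddleHodge (m : ℕ) : Prop :=
  ∀ ⦃X : SchemeOver ℂ⦄, IsSmoothProjective (2 * m) X →
    ∀ c : complexBetti X (2 * m), IsRationalClass c → IsOfHodgeType (2 * m) X (2 * m) m m c →
      c ∈ algebraicClasses X m

/-- Specialisation: the Hodge conjecture implies its middle-degree instances.
[cite: Deligne2000, §1] -/
theorem middleHodge_of_hodgeConjecture (h : _root_.HodgeConjecture) (m : ℕ) : MiddleHodge m :=
  fun _ hX c hc hpp => (h hX).2 m c hc hpp

/-- **Brosnan–Fang–Nie–Pearlstein, Lemma 48, at summit level**: if the Hodge conjecture holds in the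
middle degree of every even-dimensional smooth projective complex variety, it holds in every degree on
every smooth projective complex variety. Proof: the tree's unconditional reduction theorem
`hodgeConjectureFor_of_middleDimension_holds` (product with `ℙʳ`: `pr₁^*`, cup product with
`pr₂^* hʳ`, `pr₁_*`; Hodge models exist by `nonempty_hodgeModel_holds`).
[cite: BrosnanFangNiePearlstein2009, §6 Lemma 48] -/
theorem hodgeConjecture_of_forall_middleHodge (h : ∀ m, MiddleHodge m) : _root_.HodgeConjecture :=
  fun _ _ hX => hodgeConjectureFor_of_middleDimension_holds (fun m _ hY c hc hpp => h m hY c hc hpp) hX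

/-- **The middle-degree form of the summit**: `HodgeConjecture ↔ ∀ m, MiddleHodge m`.
[cite: BrosnanFangNiePearlstein2009, §6 Lemma 48] [cite: Deligne2000, §1] -/
theorem hodgeConjecture_iff_forall_middleHodge : _root_.HodgeConjecture ↔ ∀ m, MiddleHodge m :=
  ⟨middleHodge_of_hodgeConjecture, hodgeConjecture_of_forall_middleHodge⟩

/-- `m = 0`: Hodge classes of degree `0` on a point are algebraic (an instance of the tree's theorem
"the Hodge conjecture holds in dimension `≤ 3`"). [cite: VoisinHodgeI2002, §11.3] -/
theorem middleHodge_zero : MiddleHodge 0 :=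
  fun _ hX c hc hpp => (hodgeConjectureFor_of_dim_le_three_holds (by norm_num) hX).2 0 c hc hpp

/-- `m = 1`: rational `(1,1)`-classes on a smooth projective surface are algebraic — the Lefschetz
theorem on `(1,1)`-classes, in the tree the theorem `lefschetzOneOne_rational_holds`, consumed through
`hodgeConjectureFor_of_dim_le_three_holds`. [cite: VoisinHodgeI2002, Thm. 11.30] -/
theorem middleHodge_one : MiddleHodge 1 :=
  fun _ hX c hc hpp => (hodgeConjectureFor_of_dim_le_three_holds (by norm_num) hX).2 1 c hc hpp

/-- The cases `m ≤ 1` of `MiddleHodge` are theorems. [cite: VoisinHodgeI2002, Thm. 11.30] -/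
theorem middleHodge_of_le_one {m : ℕ} (hm : m ≤ 1) : MiddleHodge m := by
  interval_cases m
  · exact middleHodge_zero
  · exact middleHodge_one

/-- **The summit reduced to its first open parameter range**:
`HodgeConjecture ↔ ∀ m ≥ 2, MiddleHodge m` — the Hodge conjecture is equivalent to the algebraicity of
rational `(m, m)`-classes on `2m`-folds for `m ≥ 2`, the first open instance being `(2,2)`-classes on
fourfolds. [cite: BrosnanFangNiePearlstein2009, §6 Lemma 48] [cite: VoisinHodgeI2002, Thm. 11.30] -/
theorem hodgeConjecture_iff_forall_two_le_middleHodge :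
    _root_.HodgeConjecture ↔ ∀ m, 2 ≤ m → MiddleHodge m := by
  refine hodgeConjecture_iff_forall_middleHodge.trans ⟨fun h m _ => h m, fun h m => ?_⟩
  rcases Nat.lt_or_ge m 2 with hm | hm
  · exact middleHodge_of_le_one (Nat.lt_succ_iff.mp hm)
  · exact h m hm

/-- Pointwise form of the backward direction, for use one variety at a time: the middle-degree Hodge
conjecture for all `m ≥ 2` gives `HodgeConjectureFor n X` for every smooth projective `X`.
[cite: BrosnanFangNiePearlstein2009, §6 Lemma 48] -/
theorem hodgeConjectureFor_of_forall_two_le_middleHodge (h : ∀ m, 2 ≤ m → MiddleHodge m)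
    {n : ℕ} {X : SchemeOver ℂ} (hX : IsSmoothProjective n X) : HodgeConjectureFor n X :=
  hodgeConjecture_iff_forall_two_le_middleHodge.mpr h hX

end Summit.HodgeConjecture.HodgeConjecture.Theorems.SoloBlind

end
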